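import Summits.HodgeConjecture.HodgeConjecture.Theorems.F0P3cStCharTSUpTrAssembly              -- ★ (A1′)-F p852635 (LH10-p01): `upTransferLB_concrete` (the LB statement; this file proves its type MINUS `hLB`) and every ★ name its proof consumes
import Summits.HodgeConjecture.HodgeConjecture.Theorems.F0P3cStCharTSUpTrAssemblyFullCore      -- ★ (U3)-core p852972 (this seat): `upTransfer_of_inputs`
import Summits.HodgeConjecture.HodgeConjecture.Theorems.F0P3cStCharTSUpTrSlotTransport         -- ★ (U1) p852935 (this seat): `ellipticTorusSum_upIntegrand_eq_of_inputs`
import Summits.HodgeConjecture.HodgeConjecture.Theorems.F0P3cStCharTSUpTrSplitSlot             -- ★ (U2) p852979 (this seat): `splitTorus_upIntegrand_eq_of_inputs`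
import Summits.HodgeConjecture.HodgeConjecture.Theorems.F0P3cStCharTSUpTrSplitFibreOne         -- ★ (U2b) p852983 (this seat): `hone_splitTorusH`
import Summits.HodgeConjecture.HodgeConjecture.Theorems.F0P3cStCharTSUpTrStableTorusIntegrable -- ★ (U4) p852996 (this seat): `integrable_stableTorusTerm_of_integrable`
import Summits.HodgeConjecture.HodgeConjecture.Theorems.F0P3cStCharTSEllInnerConcreteHead      -- ★ ELL-INNER F-head p852706 (F0P3a-p06): brings ★ (E2b)-C `exists_slotMaps`, ★ F-core helpers `hcomplete_of_hcovHO`/`hirred_of_hncHO`/`hexh_hinj_of_hψuniq`, ★ (E2) FibreEnum, ★ (E6) IndexTwo, ★ (E0b) CoverLanding, ★ (E0)′ PerT, ★ EllInnerMeasures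
import Summits.HodgeConjecture.HodgeConjecture.Theorems.F0P3cStCharTSRung0Cartan               -- ★ INSTANTIATE-CARTAN: brings ★ CARTAN-ALL `exists_cartanAll_weylShape`, ★ (E3) `exists_haar_cartan_compactCore_eq_one`
import HarnessLib

/-!
# F0 · P3c · ROAD «UP-TR» (A1″) «UP-TR-FULL», FILE U3-head: `upTransfer_concrete` — ★ (A1′)-F `upTransferLB_concrete`'s TYPE with the local-boundedness antecedent DELETED
# (print's general-`α` clause 3 of Lemma 12.5.1: `∫_G f · α^G = ∫_H f^H · α` for EVERY measurable stable class function `α` with both sides integrable; Rogawski 1990 §12.5 pp. 182–185)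

Cell `pub/hodgecm-mathlib`, crux H413 = `stmt-HodgeConjecture-24833` (lane `--supports … --as helper`, count-neutral); seat F0P2-p01 (g25) ((A1″) pen; LEAD F0P3a-plan (g16) T15-04 «GO-LOW»;
CENSUS (A1″) `F0/P2/p01/g24/uptr/CENSUS-A1pp.v1.F0P2p01g24.md`).  THEOREMS ONLY (no definition ∕ instance ∕ notation ∕ named fact ∕ `sorry`); ★-only imports; axioms TRIO.

WHAT.  `upTransfer_concrete` = ★ F :63–115 with :82–86 (the binder `hLB : ∀ C compact, ∃ B, ∀ s ∈ C, G-regular s → ‖D_H(s)·α(s)‖ ≤ B`) DELETED and NOTHING ELSE MOVED (LEAD T15-04 KILL clause).  PROOF: the `H`-side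
of ★ F :116–172 verbatim ((H1′) all-shapes Cartan system, (X2) embeddings, (H6a′) twist and count, THE core-one Haar measures, conjugation families, ★ (F7b) `hSW`); the `G`-side Cartan data as ★
INSTANTIATE-CARTAN (★ CARTAN-ALL + ★ (E3)); then ★ (U3)-core `upTransfer_of_inputs` with `hEll` := ★ (U1) on the compact members `SH.erase M_H` (slots ★ (E2b)-C + ★ (E2), (E0)′ ★ PerT, `hnm` ★ (E6),
`hP2σ` ★ (P2) at each slot on the embedding transversal, `hIG` per elliptic `G`-torus ★ (A0) §3 at the ★ (N4-A) socket, `hIH` per compact `H`-torus ★ (U4) for the ARBITRARY `f^H`) and `hM` := ★ (U2) at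
the split members (`hone` ★ (U2b), `hP2` ★ (F2), `hIGM` ★ (A0) at `M`).  No integral is split below a torus; no local boundedness is used anywhere.
HONEST LABEL: count-neutral; the UP-TR block consequent `hUpTr` left the organ at ED. 26 on the LB reading and does not move; what moves is the CARD caveat «print's general-`α` clause 3
NOT claimed in house», struck at the next card edition (LEAD T15-04: rides free, no rider); HC_CM is proved only modulo the printed citations (hLiu418 24832 ∕ h413 24833) until rung 0 closes.

## References
* [Rogawski1990] J. D. Rogawski, *Automorphic Representations of Unitary Groups in Three Variables*, Ann. of Math. Stud. 123 (1990), §12.5 pp. 182–185 (the display defining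
  `α ↦ α^G`; Lemma 12.5.1 and its six-line proof), §4.9 p. 55, §4.3 (4.3.1) p. 43, §3.6 pp. 28–31.
* [LanglandsShelstad1987] R. P. Langlands, D. Shelstad, *On the definition of transfer factors*, Math. Ann. 278 (1987), §1.3.
* [HarishChandra1970] Harish-Chandra (notes by G. van Dijk), *Harmonic analysis on reductive p-adic groups*, LNM 162 (1970), Part V §4 Lemma 42.
-/

set_option autoImplicit false
-- the mandated namespace has the single-problem summit's repeated segment (`HodgeConjecture.HodgeConjecture`)
set_option linter.dupNamespace false

noncomputable section

open MeasureTheory Measure Set Filter Topology Function NumberField IsDedekindDomain Matrix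
open Literature.MeasureTheory.Group
open Literature.NumberTheory.Automorphic Literature.NumberTheory.Automorphic.UnitaryGroup Literature.NumberTheory.Rogawski1990
open Literature.NumberTheory.GaloisRepresentations
open Summit.HodgeConjecture.HodgeConjecture.Cruxes.H413
open scoped ENNReal NNReal MatrixGroups Pointwise Classical

namespace Summit.HodgeConjecture.HodgeConjecture.Cruxes.H413.F0P3cStCharTSUpTrAssemblyFull

set_option maxHeartbeats 3200000 in
set_option synthInstance.maxHeartbeats 400000 in
-- long statement; instance-term unification on the CM local carriers (class of ★ F ∕ ★ (P1))
/-- **(A1″) «UP-TR-FULL» — the up-transfer identity WITHOUT local boundedness.**  `v` non-split (`hns`), `νHv`, `νQv` Haar, `mHv`, `mQv` canonical, `μ` unitary.  For every measurable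
`α : H_v → ℂ` which is a stable class function on the `G`-regular set, every `f ∈ 𝒮(U(Φ₃)(L⁺_v))`, every `f^H : H_v → ℂ` with `Φ^st(γ_H, f^H) = Σ Δ‴(γ_H, γ) Φ(γ, f)` ((4.3.1)), `f · α^G` and
`f^H · α` integrable: **`∫_G f(g) α^G(g) dνQv(g) = ∫_H f^H(h) α(h) dνHv(h)`** — ★ F `upTransferLB_concrete`'s statement with the binder `hLB` deleted (print's general-`α` clause 3).  (★ F's binder `hμu : μ.IsUnitary` is kept, spelled `_hμu`, for drop-in use at ★ F's call sites; the proof does not need unitarity — the TYPE is ★ F's minus `hLB` up to this binder's name.)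
[cite: Rogawski1990, §12.5 pp. 182–185, Lemma 12.5.1; §4.9 p. 55; §4.3 (4.3.1) p. 43] [cite: LanglandsShelstad1987, §1.3] [cite: HarishChandra1970, Lemma 42] -/
theorem upTransfer_concrete (L : Type) [Field L] [NumberField L] [IsCMField L] (v : HeightOneSpectrum (𝓞 ↥(maximalRealSubfield L)))
    (hns : ∀ w : PlacesOver L v, IsCMField.complexConj L • w.1 = w.1)
    [MeasurableSpace ((UnitaryGroup.cmDatum L 2 (Matrix.of fun i j : Fin 2 => if i.val + j.val + 1 = 2 then (1 : L) else 0)).Local v × (UnitaryGroup.cmDatum L 1 (Matrix.of fun i j : Fin 1 => if i.val + j.val + 1 = 1 then (1 : L) else 0)).Local v)] [BorelSpace ((UnitaryGroup.cmDatum L 2 (Matrix.of fun i j : Fin 2 => if i.val + j.val + 1 = 2 then (1 : L) else 0)).Local v × (UnitaryGroup.cmDatum L 1 (Matrix.of fun i j : Fin 1 => if i.val + j.val + 1 = 1 then (1 : L) else 0)).Local v)] [MeasurableSpace (Gqs L v)] [BorelSpace (Gqs L v)]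
    (νHv : Measure ((UnitaryGroup.cmDatum L 2 (Matrix.of fun i j : Fin 2 => if i.val + j.val + 1 = 2 then (1 : L) else 0)).Local v × (UnitaryGroup.cmDatum L 1 (Matrix.of fun i j : Fin 1 => if i.val + j.val + 1 = 1 then (1 : L) else 0)).Local v)) (νQv : Measure (Gqs L v))
    [νHv.IsHaarMeasure] [νHv.IsMulRightInvariant] [νQv.IsHaarMeasure] [νQv.IsMulRightInvariant]
    [∀ a : ((UnitaryGroup.cmDatum L 2 (Matrix.of fun i j : Fin 2 => if i.val + j.val + 1 = 2 then (1 : L) else 0)).Local v × (UnitaryGroup.cmDatum L 1 (Matrix.of fun i j : Fin 1 => if i.val + j.val + 1 = 1 then (1 : L) else 0)).Local v), MeasurableSpace (((UnitaryGroup.cmDatum L 2 (Matrix.of fun i j : Fin 2 => if i.val + j.val + 1 = 2 then (1 : L) else 0)).Local v × (UnitaryGroup.cmDatum L 1 (Matrix.of fun i j : Fin 1 => if i.val + j.val + 1 = 1 then (1 : L) else 0)).Local v) ⧸ Subgroup.centralizer ({a} : Set ((UnitaryGroup.cmDatum L 2 (Matrix.of fun i j : Fin 2 => if i.val + j.val +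 1 = 2 then (1 : L) else 0)).Local v × (UnitaryGroup.cmDatum L 1 (Matrix.of fun i j : Fin 1 => if i.val + j.val + 1 = 1 then (1 : L) else 0)).Local v)))]
    [∀ a : ((UnitaryGroup.cmDatum L 2 (Matrix.of fun i j : Fin 2 => if i.val + j.val + 1 = 2 then (1 : L) else 0)).Local v × (UnitaryGroup.cmDatum L 1 (Matrix.of fun i j : Fin 1 => if i.val + j.val + 1 = 1 then (1 : L) else 0)).Local v), BorelSpace (((UnitaryGroup.cmDatum L 2 (Matrix.of fun i j : Fin 2 => if i.val + j.val + 1 = 2 then (1 : L) else 0)).Local v × (UnitaryGroup.cmDatum L 1 (Matrix.of fun i j : Fin 1 => if i.val + j.val + 1 = 1 then (1 : L) else 0)).Local v) ⧸ Subgroup.centralizer ({a} : Set ((UnitaryGroup.cmDatum L 2 (Matrix.of fun i j : Fin 2 => if i.val + j.val + 1 = 2 then (1 : L) else 0)).Local v × (UnitaryGroup.cmDatum L 1 (Matrix.of fun i j : Fin 1 => if i.val + j.val + 1 = 1 then (1 : L) else 0)).Local v)))]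
    [∀ γ : Gqs L v, MeasurableSpace (Gqs L v ⧸ Subgroup.centralizer ({γ} : Set (Gqs L v)))]
    [∀ γ : Gqs L v, BorelSpace (Gqs L v ⧸ Subgroup.centralizer ({γ} : Set (Gqs L v)))]
    (mHv : OrbitalMeasureFamily ((UnitaryGroup.cmDatum L 2 (Matrix.of fun i j : Fin 2 => if i.val + j.val + 1 = 2 then (1 : L) else 0)).Local v × (UnitaryGroup.cmDatum L 1 (Matrix.of fun i j : Fin 1 => if i.val + j.val + 1 = 1 then (1 : L) else 0)).Local v)) (mQv : OrbitalMeasureFamily (Gqs L v))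
    (hcanH : mHv.IsCanonical (IsLocalGRegular L v) νHv)
    (hcanQ : mQv.IsCanonical (fun γ => IsRegularElt (γ.val : GL (Fin 3) (UnitaryGroup.LocalRing L v))) νQv)
    (μ : HeckeCharacter L) (_hμu : μ.IsUnitary) :
    ∀ α : ((UnitaryGroup.cmDatum L 2 (Matrix.of fun i j : Fin 2 => if i.val + j.val + 1 = 2 then (1 : L) else 0)).Local v ×
        (UnitaryGroup.cmDatum L 1 (Matrix.of fun i j : Fin 1 => if i.val + j.val + 1 = 1 then (1 : L) else 0)).Local v) → ℂ,
      Measurable α →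
      Ch12Sec5.IsStableClassFunOn (IsLocalStablyConjH L v)
        {a : ((UnitaryGroup.cmDatum L 2 (Matrix.of fun i j : Fin 2 => if i.val + j.val + 1 = 2 then (1 : L) else 0)).Local v ×
          (UnitaryGroup.cmDatum L 1 (Matrix.of fun i j : Fin 1 => if i.val + j.val + 1 = 1 then (1 : L) else 0)).Local v) | IsLocalGRegular L v a} α →
      ∀ f ∈ SchwartzBruhat (Gqs L v), ∀ fH : ((UnitaryGroup.cmDatum L 2 (Matrix.of fun i j : Fin 2 => if i.val + j.val + 1 = 2 then (1 : L) else 0)).Local v ×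
          (UnitaryGroup.cmDatum L 1 (Matrix.of fun i j : Fin 1 => if i.val + j.val + 1 = 1 then (1 : L) else 0)).Local v) → ℂ,
        IsLocalDeltaTransfer L (qsForm L) v
          ((finExplicitCollection L (qsForm L) μ (finExplicitDelta_conj_left_all L (qsForm L) μ) (finExplicitDelta_conj_right_all L (qsForm L) μ)) v) mHv mQv fH f →
        Integrable (fun g : Gqs L v => f g *
          (if IsRegularElt (g.val : GL (Fin 3) (UnitaryGroup.LocalRing L v)) then
            ((((NNReal.sqrt (NNReal.sqrt ((∏ w : PlacesOver L v, IsNonarchimedeanLocalField.normAbs (w.1.adicCompletion L) (((g.val : GL (Fin 3) (UnitaryGroup.LocalRing L v)).val.charpoly.discr) w)) *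
              ((∏ w : PlacesOver L v, IsNonarchimedeanLocalField.normAbs (w.1.adicCompletion L) (((g.val : GL (Fin 3) (UnitaryGroup.LocalRing L v)).val.det) w)) ^ 2)⁻¹)) : ℝ≥0) : ℝ) : ℂ))⁻¹ *
              ∑ᶠ q : Quot (IsLocalStablyConjH L v),
                (if IsLocalGRegular L v q.out ∧ IsLocalNormPair L (qsForm L) v q.out g then
                  finTau L v q.out μ *
                    (((NNReal.sqrt (NNReal.sqrt ((∏ w : PlacesOver L v, IsNonarchimedeanLocalField.normAbs (w.1.adicCompletion L) (((q.out.1.val : GL (Fin 2) (UnitaryGroup.LocalRing L v)).val.charpoly.discr) w)) *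
                      (∏ w : PlacesOver L v, IsNonarchimedeanLocalField.normAbs (w.1.adicCompletion L) (((q.out.1.val : GL (Fin 2) (UnitaryGroup.LocalRing L v)).val.det) w))⁻¹)) : ℝ≥0) : ℝ) : ℂ) *
                    ((finKappaAt L v (qsForm L) q.out g : ℤ) : ℂ) * α q.out
                else 0)
          else 0)) νQv →
        Integrable (fun h => fH h * α h) νHv →
        ∫ g, f g *
          (if IsRegularElt (g.val : GL (Fin 3) (UnitaryGroup.LocalRing L v)) then
            ((((NNReal.sqrt (NNReal.sqrt ((∏ w : PlacesOver L v, IsNonarchimedeanLocalField.normAbs (w.1.adicCompletion L) (((g.val : GL (Fin 3) (UnitaryGroup.LocalRing L v)).val.charpoly.discr) w)) *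
              ((∏ w : PlacesOver L v, IsNonarchimedeanLocalField.normAbs (w.1.adicCompletion L) (((g.val : GL (Fin 3) (UnitaryGroup.LocalRing L v)).val.det) w)) ^ 2)⁻¹)) : ℝ≥0) : ℝ) : ℂ))⁻¹ *
              ∑ᶠ q : Quot (IsLocalStablyConjH L v),
                (if IsLocalGRegular L v q.out ∧ IsLocalNormPair L (qsForm L) v q.out g then
                  finTau L v q.out μ *
                    (((NNReal.sqrt (NNReal.sqrt ((∏ w : PlacesOver L v, IsNonarchimedeanLocalField.normAbs (w.1.adicCompletion L) (((q.out.1.val : GL (Fin 2) (UnitaryGroup.LocalRing L v)).val.charpoly.discr) w)) *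
                      (∏ w : PlacesOver L v, IsNonarchimedeanLocalField.normAbs (w.1.adicCompletion L) (((q.out.1.val : GL (Fin 2) (UnitaryGroup.LocalRing L v)).val.det) w))⁻¹)) : ℝ≥0) : ℝ) : ℂ) *
                    ((finKappaAt L v (qsForm L) q.out g : ℤ) : ℂ) * α q.out
                else 0)
          else 0) ∂νQv = ∫ h, fH h * α h ∂νHv := by
  intro α hαm hαst f hf fH hT hIG hIH
  letI : MeasurableSpace (Gqs L v ⧸ Subgroup.center (Gqs L v)) := borel _
  -- ### (H1′) the `H`-Cartan system, all shapes on one finset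
  obtain ⟨SH, hM, hZ, hcpt, hcov, hcovW, hcomplete, hirr, hnc, hirred⟩ := F0P3cStCharTSCartanAllHShapes.exists_cartanAllH_allShapes L v hns
  -- ### (X2) embeddings, partner maps, fibres
  obtain ⟨n, γc, eT, ψ, fib, hγc, hψ, heT, hZe, hψR, hψuniq, hfib⟩ := F0P3cStCharTSUpTrPsiOfEmb.exists_psi_of_embFamily L v hns SH hZ
  -- ### (H6a′) the stable twist `e` and the ONE class count `k`
  obtain ⟨w₀⟩ := (inferInstance : Nonempty (PlacesOver L v))
  obtain ⟨e, u, k, h1, h2, h3, h4, h5, h6, h7⟩ := exists_stableTwistAut_transversal L v w₀ (hns w₀)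
  have hclasses : ∀ T ∈ SH, ∀ s ∈ T, IsLocalGRegular L v s →
      ∃ C : Finset ((UnitaryGroup.cmDatum L 2 (Matrix.of fun i j : Fin 2 => if i.val + j.val + 1 = 2 then (1 : L) else 0)).Local v × (UnitaryGroup.cmDatum L 1 (Matrix.of fun i j : Fin 1 => if i.val + j.val + 1 = 1 then (1 : L) else 0)).Local v),
        (∀ x ∈ C, IsLocalStablyConjH L v s x) ∧ (∀ x ∈ C, ∀ y ∈ C, IsConj x y → x = y) ∧ (∀ y, IsLocalStablyConjH L v s y → ∃ x ∈ C, IsConj y x) ∧ C.card = k T := by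
    intro T hT s hs hreg
    obtain ⟨C, hC1, hC2, hC3, hC4, -⟩ := h7 T (hZ T hT) s hs hreg
    exact ⟨C, hC1, hC2, hC3, hC4⟩
  have hk : ∀ T : ↥SH, (k (T : Subgroup ((UnitaryGroup.cmDatum L 2 (Matrix.of fun i j : Fin 2 => if i.val + j.val + 1 = 2 then (1 : L) else 0)).Local v × (UnitaryGroup.cmDatum L 1 (Matrix.of fun i j : Fin 1 => if i.val + j.val + 1 = 1 then (1 : L) else 0)).Local v)) = 1 ∧ ∀ s : ↥(T : Subgroup ((UnitaryGroup.cmDatum L 2 (Matrix.of fun i j : Fin 2 => if i.val + j.val + 1 = 2 then (1 : L) else 0)).Local v × (UnitaryGroup.cmDatum L 1 (Matrix.of fun i j : Fin 1 => if i.val + j.val + 1 = 1 then (1 : L) else 0)).Local v)), IsLocalGRegular L v (s : ((UnitaryGroup.cmDatum L 2 (Matrix.of fun i j : Fin 2 => if i.val + j.val + 1 = 2 then (1 : L) else 0)).Local v × (UnitaryGroup.cmDatum L 1 (Matrix.of fun i j : Fin 1 => if i.val + j.val + 1 = 1 then (1 : L) else 0)).Local v)) →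
          {c : ConjClasses ((UnitaryGroup.cmDatum L 2 (Matrix.of fun i j : Fin 2 => if i.val + j.val + 1 = 2 then (1 : L) else 0)).Local v × (UnitaryGroup.cmDatum L 1 (Matrix.of fun i j : Fin 1 => if i.val + j.val + 1 = 1 then (1 : L) else 0)).Local v) | IsLocalStablyConjH L v (s : ((UnitaryGroup.cmDatum L 2 (Matrix.of fun i j : Fin 2 => if i.val + j.val + 1 = 2 then (1 : L) else 0)).Local v × (UnitaryGroup.cmDatum L 1 (Matrix.of fun i j : Fin 1 => if i.val + j.val + 1 = 1 then (1 : L) else 0)).Local v)) (Quotient.out c)} = {ConjClasses.mk (s : ((UnitaryGroup.cmDatum L 2 (Matrix.of fun i j : Fin 2 => if i.val + j.val + 1 = 2 then (1 : L) else 0)).Local v × (UnitaryGroup.cmDatum L 1 (Matrix.of fun i j : Fin 1 => if i.val + j.val + 1 = 1 then (1 : L) else 0)).Local v))} ∧ IsConj (s : ((UnitaryGroup.cmDatum L 2 (Matrix.of fun i j : Fin 2 => if i.val + j.val + 1 = 2 then (1 : L) else 0)).Local v × (UnitaryGroup.cmDatum L 1 (Matrix.of fun i j : Fin 1 => if i.val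 + j.val + 1 = 1 then (1 : L) else 0)).Local v)) (e (s : ((UnitaryGroup.cmDatum L 2 (Matrix.of fun i j : Fin 2 => if i.val + j.val + 1 = 2 then (1 : L) else 0)).Local v × (UnitaryGroup.cmDatum L 1 (Matrix.of fun i j : Fin 1 => if i.val + j.val + 1 = 1 then (1 : L) else 0)).Local v)))) ∨
        (k (T : Subgroup ((UnitaryGroup.cmDatum L 2 (Matrix.of fun i j : Fin 2 => if i.val + j.val + 1 = 2 then (1 : L) else 0)).Local v × (UnitaryGroup.cmDatum L 1 (Matrix.of fun i j : Fin 1 => if i.val + j.val + 1 = 1 then (1 : L) else 0)).Local v)) = 2 ∧ ∀ s : ↥(T : Subgroup ((UnitaryGroup.cmDatum L 2 (Matrix.of fun i j : Fin 2 => if i.val + j.val + 1 = 2 then (1 : L) else 0)).Local v × (UnitaryGroup.cmDatum L 1 (Matrix.of fun i j : Fin 1 => if i.val + j.val + 1 = 1 then (1 : L) else 0)).Local v)), IsLocalGRegular L v (s : ((UnitaryGroup.cmDatum L 2 (Matrix.of fun i j : Fin 2 => if i.val + j.val + 1 = 2 then (1 : L) else 0)).Local v × (UnitaryGroup.cmDatum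 L 1 (Matrix.of fun i j : Fin 1 => if i.val + j.val + 1 = 1 then (1 : L) else 0)).Local v)) →
          {c : ConjClasses ((UnitaryGroup.cmDatum L 2 (Matrix.of fun i j : Fin 2 => if i.val + j.val + 1 = 2 then (1 : L) else 0)).Local v × (UnitaryGroup.cmDatum L 1 (Matrix.of fun i j : Fin 1 => if i.val + j.val + 1 = 1 then (1 : L) else 0)).Local v) | IsLocalStablyConjH L v (s : ((UnitaryGroup.cmDatum L 2 (Matrix.of fun i j : Fin 2 => if i.val + j.val + 1 = 2 then (1 : L) else 0)).Local v × (UnitaryGroup.cmDatum L 1 (Matrix.of fun i j : Fin 1 => if i.val + j.val + 1 = 1 then (1 : L) else 0)).Local v)) (Quotient.out c)} = {ConjClasses.mk (s : ((UnitaryGroup.cmDatum L 2 (Matrix.of fun i j : Fin 2 => if i.val + j.val + 1 = 2 then (1 : L) else 0)).Local v × (UnitaryGroup.cmDatum L 1 (Matrix.of fun i j : Fin 1 => if i.val + j.val + 1 = 1 then (1 : L) else 0)).Local v)), ConjClasses.mk (e (s : ((UnitaryGroup.cmDatum L 2 (Matrix.of fun i j : Fin 2 => if i.val + j.val + 1 =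 2 then (1 : L) else 0)).Local v × (UnitaryGroup.cmDatum L 1 (Matrix.of fun i j : Fin 1 => if i.val + j.val + 1 = 1 then (1 : L) else 0)).Local v)))} ∧ ¬ IsConj (s : ((UnitaryGroup.cmDatum L 2 (Matrix.of fun i j : Fin 2 => if i.val + j.val + 1 = 2 then (1 : L) else 0)).Local v × (UnitaryGroup.cmDatum L 1 (Matrix.of fun i j : Fin 1 => if i.val + j.val + 1 = 1 then (1 : L) else 0)).Local v)) (e (s : ((UnitaryGroup.cmDatum L 2 (Matrix.of fun i j : Fin 2 => if i.val + j.val + 1 = 2 then (1 : L) else 0)).Local v × (UnitaryGroup.cmDatum L 1 (Matrix.of fun i j : Fin 1 => if i.val + j.val + 1 = 1 then (1 : L) else 0)).Local v)))) := by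
    intro T
    rcases h6 (T : Subgroup ((UnitaryGroup.cmDatum L 2 (Matrix.of fun i j : Fin 2 => if i.val + j.val + 1 = 2 then (1 : L) else 0)).Local v × (UnitaryGroup.cmDatum L 1 (Matrix.of fun i j : Fin 1 => if i.val + j.val + 1 = 1 then (1 : L) else 0)).Local v)) (hZ T.1 T.2) with ⟨hk1, h⟩ | ⟨hk2, h⟩
    · exact Or.inl ⟨hk1, fun s hs => ⟨(h s.1 s.2 hs).2, (h s.1 s.2 hs).1⟩⟩
    · exact Or.inr ⟨hk2, fun s hs => ⟨(h s.1 s.2 hs).2, (h s.1 s.2 hs).1⟩⟩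
  -- ### the torus measures: THE compact-core-normalised Haar measure on each member of `SH` (★ (H3d)), `0` elsewhere
  have htex : ∀ T : Subgroup ((UnitaryGroup.cmDatum L 2 (Matrix.of fun i j : Fin 2 => if i.val + j.val + 1 = 2 then (1 : L) else 0)).Local v × (UnitaryGroup.cmDatum L 1 (Matrix.of fun i j : Fin 1 => if i.val + j.val + 1 = 1 then (1 : L) else 0)).Local v), ∃ t : Measure ↥T, T ∈ SH → t.IsHaarMeasure ∧ t.IsInvInvariant ∧ t (compactCore ↥T) = 1 := by
    intro T
    by_cases hT : T ∈ SH
    · obtain ⟨γ₀, hγ₀, hTe⟩ := hZ T hT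
      obtain ⟨t, ht1, ht2, ht3⟩ := F0P3cStCharTSUpTrOrbInt.exists_haar_cartanH_compactCore_eq_one hγ₀ hTe
      exact ⟨t, fun _ => ⟨ht1, ht2, ht3⟩⟩
    · exact ⟨0, fun h => absurd h hT⟩
  choose tH htHpkg using htex
  have htHh : ∀ T ∈ SH, (tH T).IsHaarMeasure := fun T hT => (htHpkg T hT).1
  have htHinv : ∀ T ∈ SH, (tH T).IsInvInvariant := fun T hT => (htHpkg T hT).2.1
  have htH : ∀ T ∈ SH, tH T (compactCore ↥T) = 1 := fun T hT => (htHpkg T hT).2.2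
  -- ### conjugation families of the (abelian) members
  have hΦex : ∀ T : ↥SH, ∃ Φ : (((UnitaryGroup.cmDatum L 2 (Matrix.of fun i j : Fin 2 => if i.val + j.val + 1 = 2 then (1 : L) else 0)).Local v × (UnitaryGroup.cmDatum L 1 (Matrix.of fun i j : Fin 1 => if i.val + j.val + 1 = 1 then (1 : L) else 0)).Local v) ⧸ (T : Subgroup ((UnitaryGroup.cmDatum L 2 (Matrix.of fun i j : Fin 2 => if i.val + j.val + 1 = 2 then (1 : L) else 0)).Local v × (UnitaryGroup.cmDatum L 1 (Matrix.of fun i j : Fin 1 => if i.val + j.val + 1 = 1 then (1 : L) else 0)).Local v))) × ↥(T : Subgroup ((UnitaryGroup.cmDatum L 2 (Matrix.of fun i j : Fin 2 => if i.val + j.val + 1 = 2 then (1 : L) else 0)).Local v × (UnitaryGroup.cmDatum L 1 (Matrix.of fun i j : Fin 1 => if i.val + j.val + 1 = 1 then (1 : L) else 0)).Local v)) → ((UnitaryGroup.cmDatum L 2 (Matrix.of fun i j : Fin 2 => if i.val + j.val + 1 = 2 then (1 : L) else 0)).Local v × (UnitaryGroup.cmDatum L 1 (Matrix.of fun i j :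 Fin 1 => if i.val + j.val + 1 = 1 then (1 : L) else 0)).Local v),
      ∀ (x : ((UnitaryGroup.cmDatum L 2 (Matrix.of fun i j : Fin 2 => if i.val + j.val + 1 = 2 then (1 : L) else 0)).Local v × (UnitaryGroup.cmDatum L 1 (Matrix.of fun i j : Fin 1 => if i.val + j.val + 1 = 1 then (1 : L) else 0)).Local v)) (t : ↥(T : Subgroup ((UnitaryGroup.cmDatum L 2 (Matrix.of fun i j : Fin 2 => if i.val + j.val + 1 = 2 then (1 : L) else 0)).Local v × (UnitaryGroup.cmDatum L 1 (Matrix.of fun i j : Fin 1 => if i.val + j.val + 1 = 1 then (1 : L) else 0)).Local v))), Φ (QuotientGroup.mk x, t) = x * t * x⁻¹ := by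
    intro T
    obtain ⟨γ₀, hγ₀, hTe⟩ := hZ T.1 T.2
    exact F0P3cStCharTSWeylHypMeasure.exists_conjFamily (T : Subgroup ((UnitaryGroup.cmDatum L 2 (Matrix.of fun i j : Fin 2 => if i.val + j.val + 1 = 2 then (1 : L) else 0)).Local v × (UnitaryGroup.cmDatum L 1 (Matrix.of fun i j : Fin 1 => if i.val + j.val + 1 = 1 then (1 : L) else 0)).Local v)) (F0P3cStCharTSUpTrWIFHInst.hab_holds hγ₀ hTe)
  choose Φ hΦ using hΦex
  -- ### scalars: `f` measurable (locally constant), `D_H` measurable (continuous closed form)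
  have hfm : Measurable f := ((mem_schwartzBruhat_iff).1 hf).1.continuous.measurable
  have hdHm : Measurable fun s : ((UnitaryGroup.cmDatum L 2 (Matrix.of fun i j : Fin 2 => if i.val + j.val + 1 = 2 then (1 : L) else 0)).Local v × (UnitaryGroup.cmDatum L 1 (Matrix.of fun i j : Fin 1 => if i.val + j.val + 1 = 1 then (1 : L) else 0)).Local v) => ((NNReal.sqrt (NNReal.sqrt ((∏ w : PlacesOver L v, IsNonarchimedeanLocalField.normAbs (w.1.adicCompletion L) (((s.1.val : GL (Fin 2) (UnitaryGroup.LocalRing L v)).val.charpoly.discr) w)) * (∏ w : PlacesOver L v, IsNonarchimedeanLocalField.normAbs (w.1.adicCompletion L) (((s.1.val : GL (Fin 2) (UnitaryGroup.LocalRing L v)).val.det) w))⁻¹)) : ℝ≥0) : ℝ) :=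
    ((F0P3cStCharTSDGFieldTwo.continuous_dgFormulaTwo L v (Matrix.of fun i j : Fin 2 => if i.val + j.val + 1 = 2 then (1 : L) else 0)).comp continuous_fst).measurable
  -- ### (F5): Weyl side on `H_v` (SWIFH instantiated), with the (H5‴) socket and the per-member instances
  haveI hHi : ∀ T : ↥SH, (tH (T : Subgroup ((UnitaryGroup.cmDatum L 2 (Matrix.of fun i j : Fin 2 => if i.val + j.val + 1 = 2 then (1 : L) else 0)).Local v × (UnitaryGroup.cmDatum L 1 (Matrix.of fun i j : Fin 1 => if i.val + j.val + 1 = 1 then (1 : L) else 0)).Local v))).IsHaarMeasure := fun T => htHh T.1 T.2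
  haveI hIi : ∀ T : ↥SH, (tH (T : Subgroup ((UnitaryGroup.cmDatum L 2 (Matrix.of fun i j : Fin 2 => if i.val + j.val + 1 = 2 then (1 : L) else 0)).Local v × (UnitaryGroup.cmDatum L 1 (Matrix.of fun i j : Fin 1 => if i.val + j.val + 1 = 1 then (1 : L) else 0)).Local v))).IsInvInvariant := fun T => htHinv T.1 T.2
  have hSW := F0P3cStCharTSUpTrSWIFHInstArb.finsetSum_weighted_stableOrbitalIntegral_eq_integral_of_tubeJacobians' hns νHv hcanH SH hZ hcovW hnc Φ hΦ
    tH htHh htHinv htH (fun s : ((UnitaryGroup.cmDatum L 2 (Matrix.of fun i j : Fin 2 => if i.val + j.val + 1 = 2 then (1 : L) else 0)).Local v × (UnitaryGroup.cmDatum L 1 (Matrix.of fun i j : Fin 1 => if i.val + j.val + 1 = 1 then (1 : L) else 0)).Local v) => ((NNReal.sqrt (NNReal.sqrt ((∏ w : PlacesOver L v, IsNonarchimedeanLocalField.normAbs (w.1.adicCompletion L) (((s.1.val : GL (Fin 2) (UnitaryGroup.LocalRing L v)).val.charpoly.discr) w)) * (∏ w : PlacesOver L v, IsNonarchimedeanLocalField.normAbs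 (w.1.adicCompletion L) (((s.1.val : GL (Fin 2) (UnitaryGroup.LocalRing L v)).val.det) w))⁻¹)) : ℝ≥0) : ℝ)) (fun _ => rfl)
    (fun T hTnc => by
      exact F0P3cStCharTSUpTrWIFHFull.hJacNC_of_splitDock hns νHv SH hZ hcpt Φ hΦ (fun T => tH (T : Subgroup ((UnitaryGroup.cmDatum L 2 (Matrix.of fun i j : Fin 2 => if i.val + j.val + 1 = 2 then (1 : L) else 0)).Local v × (UnitaryGroup.cmDatum L 1 (Matrix.of fun i j : Fin 1 => if i.val + j.val + 1 = 1 then (1 : L) else 0)).Local v))) (fun T => htH T.1 T.2) T hTnc)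
    e (h5 νHv) (fun a _ => h2 a) h4 k hk
    (fun {N} hNm hN0 T hTm => F0P3cStCharTSUpTrNullSlices.ae_classOrbitalIntegral_congr_of_null hns νHv hcanH SH hZ hcpt hcovW hnc Φ hΦ
      (fun T => tH (T : Subgroup ((UnitaryGroup.cmDatum L 2 (Matrix.of fun i j : Fin 2 => if i.val + j.val + 1 = 2 then (1 : L) else 0)).Local v × (UnitaryGroup.cmDatum L 1 (Matrix.of fun i j : Fin 1 => if i.val + j.val + 1 = 1 then (1 : L) else 0)).Local v))) (fun T => htH T.1 T.2) hNm hN0 ⟨T, hTm⟩)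
    fH α hαm hαst hIH
  -- ### laws of the radicals (★ F's `fun g => √√(…)` letters)
  have hdGsq : ∀ t : Gqs L v, IsRegularElt (t.val : GL (Fin 3) (UnitaryGroup.LocalRing L v)) → ((NNReal.sqrt ((∏ w : PlacesOver L v, IsNonarchimedeanLocalField.normAbs (w.1.adicCompletion L) (((t.val : GL (Fin 3) (UnitaryGroup.LocalRing L v)).val.charpoly.discr) w)) * ((∏ w : PlacesOver L v, IsNonarchimedeanLocalField.normAbs (w.1.adicCompletion L) (((t.val : GL (Fin 3) (UnitaryGroup.LocalRing L v)).val.det) w)) ^ 2)⁻¹) : ℝ≥0) : ℝ) = ((NNReal.sqrt (NNReal.sqrt ((∏ w : PlacesOver L v, IsNonarchimedeanLocalField.normAbs (w.1.adicCompletion L) (((t.val : GL (Fin 3) (UnitaryGroup.LocalRing L v)).val.charpoly.discr) w)) * ((∏ w : PlacesOver L v, IsNonarchimedeanLocalField.normAbs (w.1.adicCompletion L) (((t.val : GL (Fin 3) (UnitaryGroup.LocalRing L v)).val.det) w)) ^ 2)⁻¹)) : ℝ≥0) : ℝ) * ((NNReal.sqrt (NNReal.sqrt ((∏ w : PlacesOver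 L v, IsNonarchimedeanLocalField.normAbs (w.1.adicCompletion L) (((t.val : GL (Fin 3) (UnitaryGroup.LocalRing L v)).val.charpoly.discr) w)) * ((∏ w : PlacesOver L v, IsNonarchimedeanLocalField.normAbs (w.1.adicCompletion L) (((t.val : GL (Fin 3) (UnitaryGroup.LocalRing L v)).val.det) w)) ^ 2)⁻¹)) : ℝ≥0) : ℝ) :=
    fun t _ => by rw [← NNReal.coe_mul, NNReal.mul_self_sqrt]
  have hDHst := F0P3cStCharTSUpTrClaimPRadical.radicalH_eq_of_isLocalGRegular_of_isLocalStablyConjH L v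
  have hαstE : Ch12Sec5.IsStableClassFunOn (IsLocalStablyConjH L v) {a : ((UnitaryGroup.cmDatum L 2 (Matrix.of fun i j : Fin 2 => if i.val + j.val + 1 = 2 then (1 : L) else 0)).Local v × (UnitaryGroup.cmDatum L 1 (Matrix.of fun i j : Fin 1 => if i.val + j.val + 1 = 1 then (1 : L) else 0)).Local v) | IsLocalGRegular L v a ∧ IsCompact ((Subgroup.centralizer ({a} : Set ((UnitaryGroup.cmDatum L 2 (Matrix.of fun i j : Fin 2 => if i.val + j.val + 1 = 2 then (1 : L) else 0)).Local v × (UnitaryGroup.cmDatum L 1 (Matrix.of fun i j : Fin 1 => if i.val + j.val + 1 = 1 then (1 : L) else 0)).Local v)) : Subgroup ((UnitaryGroup.cmDatum L 2 (Matrix.of fun i j : Fin 2 => if i.val + j.val + 1 = 2 then (1 : L) else 0)).Local v × (UnitaryGroup.cmDatum L 1 (Matrix.of fun i j : Fin 1 => if i.val + j.val + 1 = 1 then (1 : L) else 0)).Local v)) : Set ((UnitaryGroup.cmDatum L 2 (Matrix.of fun i j : Fin 2 => if i.val + j.val + 1 = 2 then (1 : L) else 0)).Local v × (UnitaryGroup.cmDatum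 L 1 (Matrix.of fun i j : Fin 1 => if i.val + j.val + 1 = 1 then (1 : L) else 0)).Local v))} α :=
    ⟨fun t ht => hαst.1 t ht.1, fun s hs s' h => hαst.2 s hs.1 s' h⟩
  -- `α^G` is a class function on the regular set
  have hupc : ∀ x t : Gqs L v, IsRegularElt (t.val : GL (Fin 3) (UnitaryGroup.LocalRing L v)) → (if IsRegularElt ((x * t * x⁻¹).val : GL (Fin 3) (UnitaryGroup.LocalRing L v)) then ((((NNReal.sqrt (NNReal.sqrt ((∏ w : PlacesOver L v, IsNonarchimedeanLocalField.normAbs (w.1.adicCompletion L) ((((x * t * x⁻¹).val : GL (Fin 3) (UnitaryGroup.LocalRing L v)).val.charpoly.discr) w)) * ((∏ w : PlacesOver L v, IsNonarchimedeanLocalField.normAbs (w.1.adicCompletion L) ((((x * t * x⁻¹).val : GL (Fin 3) (UnitaryGroup.LocalRing L v)).val.det) w)) ^ 2)⁻¹)) : ℝ≥0) : ℝ) : ℂ))⁻¹ * ∑ᶠ q : Quot (IsLocalStablyConjH L v), (if IsLocalGRegular L v q.out ∧ IsLocalNormPair L (qsForm L) v q.out (x * t * x⁻¹) then finTau L v q.out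 μ * (((NNReal.sqrt (NNReal.sqrt ((∏ w : PlacesOver L v, IsNonarchimedeanLocalField.normAbs (w.1.adicCompletion L) (((q.out.1.val : GL (Fin 2) (UnitaryGroup.LocalRing L v)).val.charpoly.discr) w)) * (∏ w : PlacesOver L v, IsNonarchimedeanLocalField.normAbs (w.1.adicCompletion L) (((q.out.1.val : GL (Fin 2) (UnitaryGroup.LocalRing L v)).val.det) w))⁻¹)) : ℝ≥0) : ℝ) : ℂ) * ((finKappaAt L v (qsForm L) q.out (x * t * x⁻¹) : ℤ) : ℂ) * α q.out else 0) else 0) = (if IsRegularElt (t.val : GL (Fin 3) (UnitaryGroup.LocalRing L v)) then ((((NNReal.sqrt (NNReal.sqrt ((∏ w : PlacesOver L v, IsNonarchimedeanLocalField.normAbs (w.1.adicCompletion L) (((t.val : GL (Fin 3) (UnitaryGroup.LocalRing L v)).val.charpoly.discr) w)) * ((∏ w : PlacesOver L v, IsNonarchimedeanLocalField.normAbs (w.1.adicCompletion L) (((t.val : GL (Fin 3) (UnitaryGroup.LocalRing L v)).val.det) w)) ^ 2)⁻¹)) : ℝ≥0) : ℝ) : ℂ))⁻¹ * ∑ᶠ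 q : Quot (IsLocalStablyConjH L v), (if IsLocalGRegular L v q.out ∧ IsLocalNormPair L (qsForm L) v q.out t then finTau L v q.out μ * (((NNReal.sqrt (NNReal.sqrt ((∏ w : PlacesOver L v, IsNonarchimedeanLocalField.normAbs (w.1.adicCompletion L) (((q.out.1.val : GL (Fin 2) (UnitaryGroup.LocalRing L v)).val.charpoly.discr) w)) * (∏ w : PlacesOver L v, IsNonarchimedeanLocalField.normAbs (w.1.adicCompletion L) (((q.out.1.val : GL (Fin 2) (UnitaryGroup.LocalRing L v)).val.det) w))⁻¹)) : ℝ≥0) : ℝ) : ℂ) * ((finKappaAt L v (qsForm L) q.out t : ℤ) : ℂ) * α q.out else 0) else 0) := by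
    intro c x hx
    have hreg : IsRegularElt ((c * x * c⁻¹).val : GL (Fin 3) (UnitaryGroup.LocalRing L v)) := (F0P3cStCharTSWeylCartanRadial.isRegularElt_conj_val_iff L v c x).2 hx
    rw [if_pos hreg, if_pos hx, F0P3cStCharTSDGFieldReg.dgFormula_conj L v x c]
    congr 1
    refine finsum_congr fun q => ?_
    by_cases hRq : IsLocalNormPair L (qsForm L) v q.out x
    · have hR' : IsLocalNormPair L (qsForm L) v q.out (c * x * c⁻¹) := F0P3cStCharTSUpTrClaimP.isLocalNormPair_of_isConj_right L v q.out (isConj_iff.2 ⟨c, rfl⟩) hRq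
      simp only [hRq, hR', and_true, finKappaAt_conj_right L v (qsForm L) q.out x c hRq]
    · have hR' : ¬ IsLocalNormPair L (qsForm L) v q.out (c * x * c⁻¹) := fun h =>
        hRq (F0P3cStCharTSUpTrClaimP.isLocalNormPair_of_isConj_right L v q.out (isConj_iff.2 ⟨c, rfl⟩ : IsConj x (c * x * c⁻¹)).symm h)
      simp only [hRq, hR', and_false, if_false]
  -- ### the `G`-side Cartan representatives `C ∋ M` (★ CARTAN-ALL) with THE core-one Haar measures (★ (E3)), as ★ INSTANTIATE-CARTAN
  obtain ⟨C, hMC, hZC, hcptC, hcovC, hncC⟩ := F0P3cStCharTSCartanAll.exists_cartanAll_weylShape L v hns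
  have hexG : ∀ T' ∈ C, ∃ tT : Measure ↥T', tT.IsHaarMeasure ∧ tT.IsInvInvariant ∧ tT (compactCore ↥T') = 1 := fun T' hT' => by
    obtain ⟨γ₀, hγ₀, hTe⟩ := hZC T' hT'
    exact F0P3cStCharTSWeylCartanOrbInt.exists_haar_cartan_compactCore_eq_one hγ₀ hTe
  obtain ⟨μTf, hμTf⟩ : ∃ μTf : (T' : Subgroup (Gqs L v)) → Measure ↥T', ∀ T' ∈ C, (μTf T').IsHaarMeasure ∧ (μTf T').IsInvInvariant ∧ μTf T' (compactCore ↥T') = 1 :=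
    ⟨fun T' => if h : T' ∈ C then (hexG T' h).choose else 0, fun T' h => by simp only [dif_pos h]; exact (hexG T' h).choose_spec⟩
  have hHaarC : ∀ T' ∈ C, (μTf T').IsHaarMeasure := fun T' h => (hμTf T' h).1
  have hinvC : ∀ T' ∈ C, (μTf T').IsInvInvariant := fun T' h => (hμTf T' h).2.1
  have hcoreC : ∀ T' ∈ C, μTf T' (compactCore ↥T') = 1 := fun T' h => (hμTf T' h).2.2
  obtain ⟨m₀, hm₀, hMeq⟩ := hZC (cmBorelTriple L 3 v).M hMC
  have hMnc := F0P3cStCharTSCartanFields.not_isCompact_cmTorus L v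
  -- ### the elliptic members `Sell := C ∖ {M}` in (E0)'s letters
  have hcartO : ∀ T ∈ (C.erase (cmBorelTriple L 3 v).M), IsCompact (T : Set (Gqs L v)) ∧ ∃ γ₀ : Gqs L v, IsRegularElt (γ₀.val : GL (Fin 3) (UnitaryGroup.LocalRing L v)) ∧ T = Subgroup.centralizer ({γ₀} : Set (Gqs L v)) :=
    fun T hT => ⟨hcptC T (Finset.mem_of_mem_erase hT) (Finset.ne_of_mem_erase hT), hZC T (Finset.mem_of_mem_erase hT)⟩
  have hncG : ∀ T' ∈ (C.erase (cmBorelTriple L 3 v).M), ∀ T'' ∈ (C.erase (cmBorelTriple L 3 v).M), T' ≠ T'' → ∀ y : Gqs L v, ¬ ∀ h : Gqs L v, h ∈ T'' ↔ y⁻¹ * h * y ∈ T' :=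
    fun T' hT' T'' hT'' => hncC T' (Finset.mem_of_mem_erase hT') T'' (Finset.mem_of_mem_erase hT'')
  have hHaarGO : ∀ T ∈ (C.erase (cmBorelTriple L 3 v).M), (μTf T).IsHaarMeasure := fun T hT => hHaarC T (Finset.mem_of_mem_erase hT)
  have hcoreGO : ∀ T ∈ (C.erase (cmBorelTriple L 3 v).M), μTf T (compactCore ↥T) = 1 := fun T hT => hcoreC T (Finset.mem_of_mem_erase hT)
  have hcovGO : ∀ γ : Gqs L v, IsRegularElt (γ.val : GL (Fin 3) (UnitaryGroup.LocalRing L v)) → ∃ T' ∈ insert (cmBorelTriple L 3 v).M (C.erase (cmBorelTriple L 3 v).M), ∃ x : Gqs L v, ∀ g : Gqs L v, g ∈ Subgroup.centralizer ({γ} : Set (Gqs L v)) ↔ x⁻¹ * g * x ∈ T' := by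
    have hie : insert (cmBorelTriple L 3 v).M (C.erase (cmBorelTriple L 3 v).M) = C := Finset.insert_erase hMC
    rw [hie]; exact hcovC
  -- ### the `H`-side split member and the compact members `SHc := SH ∖ {M_H}`
  have hMHnc := F0P3cStCharTSCartanSplitTwoH.not_isCompact_splitTorusH L v hns
  have hZc : ∀ T ∈ (SH.erase ((cmBorelTriple L 2 v).M.prod ⊤)), ∃ γ₀ : ((UnitaryGroup.cmDatum L 2 (Matrix.of fun i j : Fin 2 => if i.val + j.val + 1 = 2 then (1 : L) else 0)).Local v × (UnitaryGroup.cmDatum L 1 (Matrix.of fun i j : Fin 1 => if i.val + j.val + 1 = 1 then (1 : L) else 0)).Local v), IsLocalGRegular L v γ₀ ∧ T = Subgroup.centralizer ({γ₀} : Set ((UnitaryGroup.cmDatum L 2 (Matrix.of fun i j : Fin 2 => if i.val + j.val + 1 = 2 then (1 : L) else 0)).Local v × (UnitaryGroup.cmDatum L 1 (Matrix.of fun i j : Fin 1 => if i.val + j.val + 1 = 1 then (1 : L) else 0)).Local v)) := fun T hT => hZ T (Finset.mem_of_mem_erase hT)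
  have hKHc : ∀ T ∈ (SH.erase ((cmBorelTriple L 2 v).M.prod ⊤)), IsCompact (T : Set ((UnitaryGroup.cmDatum L 2 (Matrix.of fun i j : Fin 2 => if i.val + j.val + 1 = 2 then (1 : L) else 0)).Local v × (UnitaryGroup.cmDatum L 1 (Matrix.of fun i j : Fin 1 => if i.val + j.val + 1 = 1 then (1 : L) else 0)).Local v)) := fun T hT => hcpt T (Finset.mem_of_mem_erase hT) (Finset.ne_of_mem_erase hT)
  have hγcc : ∀ T ∈ (SH.erase ((cmBorelTriple L 2 v).M.prod ⊤)), ∀ i : Fin (n T), IsRegularElt ((γc T i).val : GL (Fin 3) (UnitaryGroup.LocalRing L v)) := fun T hT => hγc T (Finset.mem_of_mem_erase hT)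
  have heTc : ∀ T ∈ (SH.erase ((cmBorelTriple L 2 v).M.prod ⊤)), ∀ (i : Fin (n T)) (s : ↥T), IsLocalNormPair L (qsForm L) v s.1 ((eT T i s : ↥(Subgroup.centralizer ({γc T i} : Set (Gqs L v)))) : Gqs L v) := fun T hT => heT T (Finset.mem_of_mem_erase hT)
  have hψc : ∀ T ∈ (SH.erase ((cmBorelTriple L 2 v).M.prod ⊤)), ∀ (i : Fin (n T)) (s : ↥T), ψ T i s.1 = ((eT T i s : ↥(Subgroup.centralizer ({γc T i} : Set (Gqs L v)))) : Gqs L v) := fun T hT => hψ T (Finset.mem_of_mem_erase hT)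
  have hfibc : ∀ g : Gqs L v, ∀ T ∈ (SH.erase ((cmBorelTriple L 2 v).M.prod ⊤)), ∀ (i : Fin (n T)) (x : ((UnitaryGroup.cmDatum L 2 (Matrix.of fun i j : Fin 2 => if i.val + j.val + 1 = 2 then (1 : L) else 0)).Local v × (UnitaryGroup.cmDatum L 1 (Matrix.of fun i j : Fin 1 => if i.val + j.val + 1 = 1 then (1 : L) else 0)).Local v)), x ∈ fib g T i ↔ x ∈ T ∧ IsLocalGRegular L v x ∧ IsConj (ψ T i x) g :=
    fun g T hT => hfib g T (Finset.mem_of_mem_erase hT)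
  have hψRc : ∀ T ∈ (SH.erase ((cmBorelTriple L 2 v).M.prod ⊤)), ∀ (i : Fin (n T)), ∀ s ∈ T, IsLocalGRegular L v s → IsLocalNormPair L (qsForm L) v s (ψ T i s) := fun T hT => hψR T (Finset.mem_of_mem_erase hT)
  have hψuniqc : ∀ T ∈ (SH.erase ((cmBorelTriple L 2 v).M.prod ⊤)), ∀ s ∈ T, IsLocalGRegular L v s → ∀ g : Gqs L v, IsLocalNormPair L (qsForm L) v s g → ∃! i : Fin (n T), IsConj (ψ T i s) g :=
    fun T hT => hψuniq T (Finset.mem_of_mem_erase hT)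
  have hclassesc : ∀ T ∈ (SH.erase ((cmBorelTriple L 2 v).M.prod ⊤)), ∀ s ∈ T, IsLocalGRegular L v s →
      ∃ Cc : Finset ((UnitaryGroup.cmDatum L 2 (Matrix.of fun i j : Fin 2 => if i.val + j.val + 1 = 2 then (1 : L) else 0)).Local v × (UnitaryGroup.cmDatum L 1 (Matrix.of fun i j : Fin 1 => if i.val + j.val + 1 = 1 then (1 : L) else 0)).Local v), (∀ x ∈ Cc, IsLocalStablyConjH L v s x) ∧ (∀ x ∈ Cc, ∀ y ∈ Cc, IsConj x y → x = y) ∧ (∀ y, IsLocalStablyConjH L v s y → ∃ x ∈ Cc, IsConj y x) ∧ Cc.card = k T :=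
    fun T hT => hclasses T (Finset.mem_of_mem_erase hT)
  have htHhc : ∀ T ∈ (SH.erase ((cmBorelTriple L 2 v).M.prod ⊤)), (tH T).IsHaarMeasure := fun T hT => htHh T (Finset.mem_of_mem_erase hT)
  have htHc : ∀ T ∈ (SH.erase ((cmBorelTriple L 2 v).M.prod ⊤)), tH T (compactCore ↥T) = 1 := fun T hT => htH T (Finset.mem_of_mem_erase hT)
  have hprobc : ∀ T ∈ (SH.erase ((cmBorelTriple L 2 v).M.prod ⊤)), IsProbabilityMeasure (tH T) :=
    fun T hT => F0P3cStCharTSEllInnerMeasures.isProbabilityMeasure_of_apply_compactCore_eq_one T (hKHc T hT) (tH T) (htHc T hT)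
  have hirredc : ∀ T ∈ (SH.erase ((cmBorelTriple L 2 v).M.prod ⊤)), ∀ T' ∈ (SH.erase ((cmBorelTriple L 2 v).M.prod ⊤)), ∀ s ∈ T, ∀ s' ∈ T', IsLocalGRegular L v s → IsConj s s' → T = T' :=
    fun T hT T' hT' => hirred T (Finset.mem_of_mem_erase hT) T' (Finset.mem_of_mem_erase hT')
  have hcompletec : ∀ h : ((UnitaryGroup.cmDatum L 2 (Matrix.of fun i j : Fin 2 => if i.val + j.val + 1 = 2 then (1 : L) else 0)).Local v × (UnitaryGroup.cmDatum L 1 (Matrix.of fun i j : Fin 1 => if i.val + j.val + 1 = 1 then (1 : L) else 0)).Local v), IsLocalGRegular L v h → IsCompact ((Subgroup.centralizer ({h} : Set ((UnitaryGroup.cmDatum L 2 (Matrix.of fun i j : Fin 2 => if i.val + j.val + 1 = 2 then (1 : L) else 0)).Local v × (UnitaryGroup.cmDatum L 1 (Matrix.of fun i j : Fin 1 => if i.val + j.val + 1 = 1 then (1 : L) else 0)).Local v)) : Subgroup ((UnitaryGroup.cmDatum L 2 (Matrix.of fun i j : Fin 2 => if i.val + j.val + 1 = 2 then (1 : L) else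 0)).Local v × (UnitaryGroup.cmDatum L 1 (Matrix.of fun i j : Fin 1 => if i.val + j.val + 1 = 1 then (1 : L) else 0)).Local v)) : Set ((UnitaryGroup.cmDatum L 2 (Matrix.of fun i j : Fin 2 => if i.val + j.val + 1 = 2 then (1 : L) else 0)).Local v × (UnitaryGroup.cmDatum L 1 (Matrix.of fun i j : Fin 1 => if i.val + j.val + 1 = 1 then (1 : L) else 0)).Local v)) →
      ∃ T ∈ (SH.erase ((cmBorelTriple L 2 v).M.prod ⊤)), ∃ s ∈ T, IsConj h s := by
    intro h hh hhc
    obtain ⟨T, hT, s, hs, hconj⟩ := hcomplete h hh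
    refine ⟨T, Finset.mem_erase.2 ⟨fun hTM => hMHnc ?_, hT⟩, s, hs, hconj⟩
    -- `T = M_H` would be compact: `Z_H(s) = T` (`s` is `G`-regular) and `Z_H(s) = Z_H(c h c⁻¹)` is compact with `Z_H(h)`
    obtain ⟨c, hc⟩ := isConj_iff.1 hconj
    obtain ⟨γ₀, hγ₀, hTeq⟩ := hZ T hT
    have hsreg : IsLocalGRegular L v s := by rw [← hc]; exact (isLocalGRegular_conj_iff L c h).2 hh
    have hZs : Subgroup.centralizer ({s} : Set ((UnitaryGroup.cmDatum L 2 (Matrix.of fun i j : Fin 2 => if i.val + j.val + 1 = 2 then (1 : L) else 0)).Local v × (UnitaryGroup.cmDatum L 1 (Matrix.of fun i j : Fin 1 => if i.val + j.val + 1 = 1 then (1 : L) else 0)).Local v)) = T := F0P3cStCharTSUpTrCartanFields.centralizer_eq_cartan_of_isLocalGRegular hγ₀ hTeq ⟨s, hs⟩ hsreg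
    have hZc' : IsCompact ((Subgroup.centralizer ({s} : Set ((UnitaryGroup.cmDatum L 2 (Matrix.of fun i j : Fin 2 => if i.val + j.val + 1 = 2 then (1 : L) else 0)).Local v × (UnitaryGroup.cmDatum L 1 (Matrix.of fun i j : Fin 1 => if i.val + j.val + 1 = 1 then (1 : L) else 0)).Local v)) : Subgroup ((UnitaryGroup.cmDatum L 2 (Matrix.of fun i j : Fin 2 => if i.val + j.val + 1 = 2 then (1 : L) else 0)).Local v × (UnitaryGroup.cmDatum L 1 (Matrix.of fun i j : Fin 1 => if i.val + j.val + 1 = 1 then (1 : L) else 0)).Local v)) : Set ((UnitaryGroup.cmDatum L 2 (Matrix.of fun i j : Fin 2 => if i.val + j.val + 1 = 2 then (1 : L) else 0)).Local v × (UnitaryGroup.cmDatum L 1 (Matrix.of fun i j : Fin 1 => if i.val + j.val + 1 = 1 then (1 : L) else 0)).Local v)) := by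
      rw [← hc]
      exact F0P3cStCharTSUpTrSplitSlot.isCompact_of_forall_mem_iff_conj c (fun g => F0P3cStCharTSUpTrCover.mem_centralizer_conj_iff c h g) hhc
    rw [hZs, hTM] at hZc'
    exact hZc'
  -- ### (E2b)-C slots on the compact members, (E2) fibre letters, (E6) index two, (E0b) landing, (E0)′
  obtain ⟨cQ, σ, -, hMσ, hX, hG, hN', hD, hR, -⟩ := F0P3cStCharTSEllInnerSlotMaps.exists_slotMaps hns (SH.erase ((cmBorelTriple L 2 v).M.prod ⊤)) hZc hKHc
  have hσR := F0P3cStCharTSEllInnerFibreEnum.hσR_of_slotClauseN' L v (SH.erase ((cmBorelTriple L 2 v).M.prod ⊤)) n γc eT heTc cQ σ hN'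
  have hσpair := F0P3cStCharTSEllInnerFibreEnum.hσpair_of_slotClauseD L v (SH.erase ((cmBorelTriple L 2 v).M.prod ⊤)) cQ σ hD
  have hσexh := F0P3cStCharTSEllInnerFibreEnum.hσexh_of_slotClauseR' L v (SH.erase ((cmBorelTriple L 2 v).M.prod ⊤)) n γc eT heTc cQ σ hN' hR
  have hcQ := F0P3cStCharTSEllInnerFibreEnum.hcQ_of_slotClauses' L v (SH.erase ((cmBorelTriple L 2 v).M.prod ⊤)) n γc eT heTc cQ σ hG hN' hD hR
  have hσm : ∀ T ∈ (SH.erase ((cmBorelTriple L 2 v).M.prod ⊤)), ∀ u' : Fin (cQ T), MeasurePreserving (σ T u') (tH T) (tH T) :=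
    fun T hT u' => hMσ T hT u' (tH T) (htHhc T hT) (htHc T hT)
  obtain ⟨hexh, hinj⟩ := F0P3cStCharTSEllInnerConcrete.hexh_hinj_of_hψuniq L v (SH.erase ((cmBorelTriple L 2 v).M.prod ⊤)) n γc eT heTc ψ hψc hψuniqc
  have hnm := F0P3cStCharTSEllInnerIndexTwo.index_two_of_letters L v hns (SH.erase ((cmBorelTriple L 2 v).M.prod ⊤)) n γc eT heTc hexh hinj hZc hKHc k hclassesc
  have hcovE := F0P3cStCharTSEllInnerCoverLanding.covE_of_covGO L v (SH.erase ((cmBorelTriple L 2 v).M.prod ⊤)) n γc hγcc eT hKHc (C.erase (cmBorelTriple L 3 v).M) hcovGO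
  have hE0pkg := fun (Φ' : Gqs L v → ℂ) (hΦc : ∀ x y : Gqs L v, IsConj x y → Φ' x = Φ' y)
      (hΦ0 : ∀ x : Gqs L v, (¬ ∃ q : ((UnitaryGroup.cmDatum L 2 (Matrix.of fun i j : Fin 2 => if i.val + j.val + 1 = 2 then (1 : L) else 0)).Local v × (UnitaryGroup.cmDatum L 1 (Matrix.of fun i j : Fin 1 => if i.val + j.val + 1 = 1 then (1 : L) else 0)).Local v), IsLocalGRegular L v q ∧ IsLocalNormPair L (qsForm L) v q x) → Φ' x = 0)
      (hΦi : ∀ T' ∈ (C.erase (cmBorelTriple L 3 v).M), Integrable (fun t : ↥T' => Φ' (t : Gqs L v)) (μTf T')) =>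
    F0P3cStCharTSEllInnerGRegroupPerT.integrableOn_and_ellipticTorusSum_eq_haarOn L v hns (SH.erase ((cmBorelTriple L 2 v).M.prod ⊤)) n γc hγcc eT heTc ψ hψc fib hfibc tH htHhc hprobc hZc hKHc hcompletec hirredc
      k hclassesc hψRc hψuniqc cQ hcQ (C.erase (cmBorelTriple L 3 v).M) μTf hcartO hncG hHaarGO hcoreGO hcovE Φ' hΦc hΦ0 hΦi
  -- ### `hP2σ`: ★ (P2) AT EACH SLOT, on the embedding transversal
  have hP2σ : ∀ T ∈ (SH.erase ((cmBorelTriple L 2 v).M.prod ⊤)), ∀ (u' : Fin (cQ T)) (s : ↥T), IsLocalGRegular L v (s : ((UnitaryGroup.cmDatum L 2 (Matrix.of fun i j : Fin 2 => if i.val + j.val + 1 = 2 then (1 : L) else 0)).Local v × (UnitaryGroup.cmDatum L 1 (Matrix.of fun i j : Fin 1 => if i.val + j.val + 1 = 1 then (1 : L) else 0)).Local v)) →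
      ∑ i : Fin (n T), (((NNReal.sqrt (NNReal.sqrt ((∏ w : PlacesOver L v, IsNonarchimedeanLocalField.normAbs (w.1.adicCompletion L) (((((eT T i s : ↥(Subgroup.centralizer ({γc T i} : Set (Gqs L v)))) : Gqs L v).val : GL (Fin 3) (UnitaryGroup.LocalRing L v)).val.charpoly.discr) w)) * ((∏ w : PlacesOver L v, IsNonarchimedeanLocalField.normAbs (w.1.adicCompletion L) (((((eT T i s : ↥(Subgroup.centralizer ({γc T i} : Set (Gqs L v)))) : Gqs L v).val : GL (Fin 3) (UnitaryGroup.LocalRing L v)).val.det) w)) ^ 2)⁻¹)) : ℝ≥0) : ℝ) : ℂ) *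
          (finTau L v (σ T u' s).1 μ * (((NNReal.sqrt (NNReal.sqrt ((∏ w : PlacesOver L v, IsNonarchimedeanLocalField.normAbs (w.1.adicCompletion L) ((((σ T u' s).1.1.val : GL (Fin 2) (UnitaryGroup.LocalRing L v)).val.charpoly.discr) w)) * (∏ w : PlacesOver L v, IsNonarchimedeanLocalField.normAbs (w.1.adicCompletion L) ((((σ T u' s).1.1.val : GL (Fin 2) (UnitaryGroup.LocalRing L v)).val.det) w))⁻¹)) : ℝ≥0) : ℝ) : ℂ) * ((finKappaAt L v (qsForm L) (σ T u' s).1 ((eT T i s : ↥(Subgroup.centralizer ({γc T i} : Set (Gqs L v)))) : Gqs L v) : ℤ) : ℂ) * α (σ T u' s).1) *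
          classOrbitalIntegral mQv f (ConjClasses.mk ((eT T i s : ↥(Subgroup.centralizer ({γc T i} : Set (Gqs L v)))) : Gqs L v)) =
        ((((NNReal.sqrt (NNReal.sqrt ((∏ w : PlacesOver L v, IsNonarchimedeanLocalField.normAbs (w.1.adicCompletion L) ((((σ T u' s).1.1.val : GL (Fin 2) (UnitaryGroup.LocalRing L v)).val.charpoly.discr) w)) * (∏ w : PlacesOver L v, IsNonarchimedeanLocalField.normAbs (w.1.adicCompletion L) ((((σ T u' s).1.1.val : GL (Fin 2) (UnitaryGroup.LocalRing L v)).val.det) w))⁻¹)) : ℝ≥0) : ℝ) : ℂ)) ^ 2 * α (σ T u' s).1 * stableOrbitalIntegralRel (IsLocalStablyConjH L v) mHv fH (σ T u' s).1 := by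
    intro T hTm u' s hs
    have hσs : IsLocalGRegular L v ((σ T u' s) : ((UnitaryGroup.cmDatum L 2 (Matrix.of fun i j : Fin 2 => if i.val + j.val + 1 = 2 then (1 : L) else 0)).Local v × (UnitaryGroup.cmDatum L 1 (Matrix.of fun i j : Fin 1 => if i.val + j.val + 1 = 1 then (1 : L) else 0)).Local v)) := hG T hTm u' s hs
    have hpart : ∀ i : Fin (n T), IsLocalNormPair L (qsForm L) v (σ T u' s).1 ((eT T i s : ↥(Subgroup.centralizer ({γc T i} : Set (Gqs L v)))) : Gqs L v) := fun i => hσR T hTm u' i s hs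
    have hSx : ∀ γ ∈ (Finset.univ : Finset (Fin (n T))).image (fun i : Fin (n T) => ((eT T i s : ↥(Subgroup.centralizer ({γc T i} : Set (Gqs L v)))) : Gqs L v)), IsLocalNormPair L (qsForm L) v (σ T u' s).1 γ := by
      intro γ hγ
      obtain ⟨i, -, rfl⟩ := Finset.mem_image.1 hγ
      exact hpart i
    have hexh' : ∀ γ : Gqs L v, IsLocalNormPair L (qsForm L) v (σ T u' s).1 γ →
        ∃ γc' ∈ (Finset.univ : Finset (Fin (n T))).image (fun i : Fin (n T) => ((eT T i s : ↥(Subgroup.centralizer ({γc T i} : Set (Gqs L v)))) : Gqs L v)), IsConj γc' γ := by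
      intro γ hγ
      -- `γ ↔ σ_u s` ⇒ `γ ↔ s` (same characteristic polynomial, (X)), then exhaustion of the embeddings at `s`
      have hγreg : IsRegularElt (γ.val : GL (Fin 3) (UnitaryGroup.LocalRing L v)) := hγ.isRegularElt L (qsForm L) v hσs
      have hγs : IsLocalNormPair L (qsForm L) v s.1 γ := by
        refine (F0P3cStCharTSFibreRealise.isLocalGRegular_and_isLocalNormPair_of_charpoly_eq L v _ γ hγreg ?_).2
        rw [← hX T hTm u' s, charpoly_endoEmbLocal, ← hγ.charpoly_eq L (qsForm L) v]
      obtain ⟨i, hi⟩ := hexh T hTm s hs γ hγs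
      exact ⟨((eT T i s : ↥(Subgroup.centralizer ({γc T i} : Set (Gqs L v)))) : Gqs L v), Finset.mem_image.2 ⟨i, Finset.mem_univ _, rfl⟩, hi⟩
    have hinj' : ∀ γ ∈ (Finset.univ : Finset (Fin (n T))).image (fun i : Fin (n T) => ((eT T i s : ↥(Subgroup.centralizer ({γc T i} : Set (Gqs L v)))) : Gqs L v)),
        ∀ γ' ∈ (Finset.univ : Finset (Fin (n T))).image (fun i : Fin (n T) => ((eT T i s : ↥(Subgroup.centralizer ({γc T i} : Set (Gqs L v)))) : Gqs L v)), γ ≠ γ' → ¬ IsConj γ γ' := by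
      intro γ hγ γ' hγ' hne hc
      obtain ⟨i, -, rfl⟩ := Finset.mem_image.1 hγ
      obtain ⟨j, -, rfl⟩ := Finset.mem_image.1 hγ'
      by_cases hij : i = j
      · subst hij; exact hne rfl
      · exact hinj T hTm s hs i j hij hc
    have hinjψ : Function.Injective fun i : Fin (n T) => ((eT T i s : ↥(Subgroup.centralizer ({γc T i} : Set (Gqs L v)))) : Gqs L v) := by
      intro i j hij
      by_contra hne
      have hij' : ((eT T i s : ↥(Subgroup.centralizer ({γc T i} : Set (Gqs L v)))) : Gqs L v) = ((eT T j s : ↥(Subgroup.centralizer ({γc T j} : Set (Gqs L v)))) : Gqs L v) := hij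
      exact hinj T hTm s hs i j hne (by rw [hij'])
    have key := F0P3cStCharTSUpTrTransferSide.sum_weylDiscrThree_mul_upSummand_mul_classOrbitalIntegral_eq L v μ _ _ mQv f hns mHv fH hT hσs
      ((Finset.univ : Finset (Fin (n T))).image (fun i : Fin (n T) => ((eT T i s : ↥(Subgroup.centralizer ({γc T i} : Set (Gqs L v)))) : Gqs L v))) hSx hexh' hinj' α
    rw [Finset.sum_image fun i _ j _ h => hinjψ h] at key
    exact key
  -- ### `hIG` per member of `C` (★ (A0) §3 at the ★ (N4-A) socket), in the (U1)∕(U2) currency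
  have hIGC : ∀ T' ∈ C, Integrable (fun t : ↥T' => ((((NNReal.sqrt (NNReal.sqrt ((∏ w : PlacesOver L v, IsNonarchimedeanLocalField.normAbs (w.1.adicCompletion L) ((((t : Gqs L v).val : GL (Fin 3) (UnitaryGroup.LocalRing L v)).val.charpoly.discr) w)) * ((∏ w : PlacesOver L v, IsNonarchimedeanLocalField.normAbs (w.1.adicCompletion L) ((((t : Gqs L v).val : GL (Fin 3) (UnitaryGroup.LocalRing L v)).val.det) w)) ^ 2)⁻¹)) : ℝ≥0) : ℝ) : ℂ)) ^ 2 * (if IsRegularElt ((t : Gqs L v).val : GL (Fin 3) (UnitaryGroup.LocalRing L v)) then ((((NNReal.sqrt (NNReal.sqrt ((∏ w : PlacesOver L v, IsNonarchimedeanLocalField.normAbs (w.1.adicCompletion L) ((((t : Gqs L v).val : GL (Fin 3) (UnitaryGroup.LocalRing L v)).val.charpoly.discr) w)) * ((∏ w : PlacesOver L v, IsNonarchimedeanLocalField.normAbs (w.1.adicCompletion L) ((((t : Gqs L v).val : GL (Fin 3) (UnitaryGroup.LocalRing L v)).val.det) w)) ^ 2)⁻¹)) : ℝ≥0) : ℝ)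 : ℂ))⁻¹ * ∑ᶠ q : Quot (IsLocalStablyConjH L v), (if IsLocalGRegular L v q.out ∧ IsLocalNormPair L (qsForm L) v q.out (t : Gqs L v) then finTau L v q.out μ * (((NNReal.sqrt (NNReal.sqrt ((∏ w : PlacesOver L v, IsNonarchimedeanLocalField.normAbs (w.1.adicCompletion L) (((q.out.1.val : GL (Fin 2) (UnitaryGroup.LocalRing L v)).val.charpoly.discr) w)) * (∏ w : PlacesOver L v, IsNonarchimedeanLocalField.normAbs (w.1.adicCompletion L) (((q.out.1.val : GL (Fin 2) (UnitaryGroup.LocalRing L v)).val.det) w))⁻¹)) : ℝ≥0) : ℝ) : ℂ) * ((finKappaAt L v (qsForm L) q.out (t : Gqs L v) : ℤ) : ℂ) * α q.out else 0) else 0) * classOrbitalIntegral mQv f (ConjClasses.mk (t : Gqs L v))) (μTf T') := by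
    intro T' hT'
    haveI := hHaarC T' hT'
    haveI := hinvC T' hT'
    obtain ⟨γ₀, hγ₀, hT'eq⟩ := hZC T' hT'
    letI : MeasurableSpace (Gqs L v ⧸ T') := borel _
    haveI : BorelSpace (Gqs L v ⧸ T') := ⟨rfl⟩
    obtain ⟨Φ', hΦ'⟩ := F0P3cStCharTSWeylHypMeasure.exists_conjFamily T' (F0P3cStCharTSWeylCartanRadial.mul_comm_cartan hγ₀ hT'eq)
    have hA0 := F0P3cStCharTSUpTrTorusIntegrable.integrableOn_weighted_classFun_mul_classOrbitalIntegral hγ₀ hT'eq Φ' hΦ' hns νQv hcanQ (μTf T') (hcoreC T' hT')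
      (fun t : ↥T' => NNReal.sqrt ((∏ w : PlacesOver L v, IsNonarchimedeanLocalField.normAbs (w.1.adicCompletion L) ((((t : Gqs L v).val : GL (Fin 3) (UnitaryGroup.LocalRing L v)).val.charpoly.discr) w)) * ((∏ w : PlacesOver L v, IsNonarchimedeanLocalField.normAbs (w.1.adicCompletion L) ((((t : Gqs L v).val : GL (Fin 3) (UnitaryGroup.LocalRing L v)).val.det) w)) ^ 2)⁻¹)) (F0P3cStCharTSUpTrTubeAnyCartan.measurable_sqrt_dgRadicand_subtype L v T')
      (F0P3cStCharTSUpTrTubeSocketAnyCartan.tubeJacobianSocket_cartan L v hns νQv hγ₀ hT'eq (μTf T') (hcoreC T' hT') Φ' hΦ')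
      f (fun x : Gqs L v => (if IsRegularElt (x.val : GL (Fin 3) (UnitaryGroup.LocalRing L v)) then ((((NNReal.sqrt (NNReal.sqrt ((∏ w : PlacesOver L v, IsNonarchimedeanLocalField.normAbs (w.1.adicCompletion L) (((x.val : GL (Fin 3) (UnitaryGroup.LocalRing L v)).val.charpoly.discr) w)) * ((∏ w : PlacesOver L v, IsNonarchimedeanLocalField.normAbs (w.1.adicCompletion L) (((x.val : GL (Fin 3) (UnitaryGroup.LocalRing L v)).val.det) w)) ^ 2)⁻¹)) : ℝ≥0) : ℝ) : ℂ))⁻¹ * ∑ᶠ q : Quot (IsLocalStablyConjH L v), (if IsLocalGRegular L v q.out ∧ IsLocalNormPair L (qsForm L) v q.out x then finTau L v q.out μ * (((NNReal.sqrt (NNReal.sqrt ((∏ w : PlacesOver L v, IsNonarchimedeanLocalField.normAbs (w.1.adicCompletion L) (((q.out.1.val : GL (Fin 2) (UnitaryGroup.LocalRing L v)).val.charpoly.discr) w)) * (∏ w : PlacesOver L v, IsNonarchimedeanLocalField.normAbs (w.1.adicCompletion L) (((q.out.1.val : GL (Fin 2) (UnitaryGroup.LocalRing L v)).val.det) w))⁻¹))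 : ℝ≥0) : ℝ) : ℂ) * ((finKappaAt L v (qsForm L) q.out x : ℤ) : ℂ) * α q.out else 0) else 0)) hfm hupc hIG.integrableOn
    have hRm : MeasurableSet {t : ↥T' | IsRegularElt (((t : Gqs L v)).val : GL (Fin 3) (UnitaryGroup.LocalRing L v))} :=
      ((isOpen_setOf_isRegularElt_cmDatum_local (L := L) (H := qsForm L) (v := v) w₀ (hns w₀)).preimage continuous_subtype_val).measurableSet
    have h1 : IntegrableOn (fun t : ↥T' => ((((NNReal.sqrt (NNReal.sqrt ((∏ w : PlacesOver L v, IsNonarchimedeanLocalField.normAbs (w.1.adicCompletion L) ((((t : Gqs L v).val : GL (Fin 3) (UnitaryGroup.LocalRing L v)).val.charpoly.discr) w)) * ((∏ w : PlacesOver L v, IsNonarchimedeanLocalField.normAbs (w.1.adicCompletion L) ((((t : Gqs L v).val : GL (Fin 3) (UnitaryGroup.LocalRing L v)).val.det) w)) ^ 2)⁻¹)) : ℝ≥0) : ℝ) : ℂ)) ^ 2 * (if IsRegularElt ((t : Gqs L v).val : GL (Fin 3) (UnitaryGroup.LocalRing L v)) then ((((NNReal.sqrt (NNReal.sqrt ((∏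 w : PlacesOver L v, IsNonarchimedeanLocalField.normAbs (w.1.adicCompletion L) ((((t : Gqs L v).val : GL (Fin 3) (UnitaryGroup.LocalRing L v)).val.charpoly.discr) w)) * ((∏ w : PlacesOver L v, IsNonarchimedeanLocalField.normAbs (w.1.adicCompletion L) ((((t : Gqs L v).val : GL (Fin 3) (UnitaryGroup.LocalRing L v)).val.det) w)) ^ 2)⁻¹)) : ℝ≥0) : ℝ) : ℂ))⁻¹ * ∑ᶠ q : Quot (IsLocalStablyConjH L v), (if IsLocalGRegular L v q.out ∧ IsLocalNormPair L (qsForm L) v q.out (t : Gqs L v) then finTau L v q.out μ * (((NNReal.sqrt (NNReal.sqrt ((∏ w : PlacesOver L v, IsNonarchimedeanLocalField.normAbs (w.1.adicCompletion L) (((q.out.1.val : GL (Fin 2) (UnitaryGroup.LocalRing L v)).val.charpoly.discr) w)) * (∏ w : PlacesOver L v, IsNonarchimedeanLocalField.normAbs (w.1.adicCompletion L) (((q.out.1.val : GL (Fin 2) (UnitaryGroup.LocalRing L v)).val.det) w))⁻¹)) : ℝ≥0) : ℝ) : ℂ) * ((finKappaAt L v (qsForm L) q.out (t : Gqs L v)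 : ℤ) : ℂ) * α q.out else 0) else 0) * classOrbitalIntegral mQv f (ConjClasses.mk (t : Gqs L v)))
        {t : ↥T' | IsRegularElt (((t : Gqs L v)).val : GL (Fin 3) (UnitaryGroup.LocalRing L v))} (μTf T') := by
      refine hA0.congr_fun (fun t ht => ?_) hRm
      show ((NNReal.sqrt ((∏ w : PlacesOver L v, IsNonarchimedeanLocalField.normAbs (w.1.adicCompletion L) ((((t : Gqs L v).val : GL (Fin 3) (UnitaryGroup.LocalRing L v)).val.charpoly.discr) w)) * ((∏ w : PlacesOver L v, IsNonarchimedeanLocalField.normAbs (w.1.adicCompletion L) ((((t : Gqs L v).val : GL (Fin 3) (UnitaryGroup.LocalRing L v)).val.det) w)) ^ 2)⁻¹) : ℝ≥0) : ℝ) • ((if IsRegularElt ((t : Gqs L v).val : GL (Fin 3) (UnitaryGroup.LocalRing L v)) then ((((NNReal.sqrt (NNReal.sqrt ((∏ w : PlacesOver L v, IsNonarchimedeanLocalField.normAbs (w.1.adicCompletion L) ((((t : Gqs L v).val : GL (Fin 3) (UnitaryGroup.LocalRing L v)).val.charpoly.discr) w)) * ((∏ w : PlacesOver L v, IsNonarchimedeanLocalField.normAbs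 (w.1.adicCompletion L) ((((t : Gqs L v).val : GL (Fin 3) (UnitaryGroup.LocalRing L v)).val.det) w)) ^ 2)⁻¹)) : ℝ≥0) : ℝ) : ℂ))⁻¹ * ∑ᶠ q : Quot (IsLocalStablyConjH L v), (if IsLocalGRegular L v q.out ∧ IsLocalNormPair L (qsForm L) v q.out (t : Gqs L v) then finTau L v q.out μ * (((NNReal.sqrt (NNReal.sqrt ((∏ w : PlacesOver L v, IsNonarchimedeanLocalField.normAbs (w.1.adicCompletion L) (((q.out.1.val : GL (Fin 2) (UnitaryGroup.LocalRing L v)).val.charpoly.discr) w)) * (∏ w : PlacesOver L v, IsNonarchimedeanLocalField.normAbs (w.1.adicCompletion L) (((q.out.1.val : GL (Fin 2) (UnitaryGroup.LocalRing L v)).val.det) w))⁻¹)) : ℝ≥0) : ℝ) : ℂ) * ((finKappaAt L v (qsForm L) q.out (t : Gqs L v) : ℤ) : ℂ) * α q.out else 0) else 0) * classOrbitalIntegral mQv f (ConjClasses.mk (t : Gqs L v))) = _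
      rw [Complex.real_smul, hdGsq _ ht, Complex.ofReal_mul]; ring
    refine h1.integrable_of_forall_notMem_eq_zero (fun t ht => ?_)
    have ht' : ¬ IsRegularElt (((t : Gqs L v)).val : GL (Fin 3) (UnitaryGroup.LocalRing L v)) := ht
    rw [if_neg ht', mul_zero, zero_mul]
  -- ### `hIH` per member, for the ARBITRARY `f^H` (★ (U4)); the `G`-singular parts are null (★ `EllMassHNull`)
  have hIHall := F0P3cStCharTSUpTrStableTorusIntegrable.integrable_stableTorusTerm_of_integrable hns νHv hcanH SH hZ hcpt hcovW hnc Φ hΦ tH htHh htHinv htH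
    (fun s : ((UnitaryGroup.cmDatum L 2 (Matrix.of fun i j : Fin 2 => if i.val + j.val + 1 = 2 then (1 : L) else 0)).Local v × (UnitaryGroup.cmDatum L 1 (Matrix.of fun i j : Fin 1 => if i.val + j.val + 1 = 1 then (1 : L) else 0)).Local v) => ((NNReal.sqrt (NNReal.sqrt ((∏ w : PlacesOver L v, IsNonarchimedeanLocalField.normAbs (w.1.adicCompletion L) (((s.1.val : GL (Fin 2) (UnitaryGroup.LocalRing L v)).val.charpoly.discr) w)) * (∏ w : PlacesOver L v, IsNonarchimedeanLocalField.normAbs (w.1.adicCompletion L) (((s.1.val : GL (Fin 2) (UnitaryGroup.LocalRing L v)).val.det) w))⁻¹)) : ℝ≥0) : ℝ)) (fun _ => rfl) e (h5 νHv) (fun a _ => h2 a) h4 k hk fH α hαm hαst hIH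
  have hsingH : ∀ T ∈ SH, tH T {s : ↥T | ¬ IsLocalGRegular L v (s : ((UnitaryGroup.cmDatum L 2 (Matrix.of fun i j : Fin 2 => if i.val + j.val + 1 = 2 then (1 : L) else 0)).Local v × (UnitaryGroup.cmDatum L 1 (Matrix.of fun i j : Fin 1 => if i.val + j.val + 1 = 1 then (1 : L) else 0)).Local v))} = 0 := by
    intro T hTm
    obtain ⟨γ₀, hγ₀, hTeq⟩ := hZ T hTm
    haveI := htHh T hTm
    exact F0P3cStCharTSEllMassHNull.measure_setOf_not_isLocalGRegular_of_eq_centralizerH_eq_zero L v hns hγ₀ hTeq (tH T)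
  -- ### `hEll` := ★ (U1) on the compact members
  have hEll := F0P3cStCharTSUpTrSlotTransport.ellipticTorusSum_upIntegrand_eq_of_inputs L v μ (fun g : Gqs L v => ((NNReal.sqrt (NNReal.sqrt ((∏ w : PlacesOver L v, IsNonarchimedeanLocalField.normAbs (w.1.adicCompletion L) (((g.val : GL (Fin 3) (UnitaryGroup.LocalRing L v)).val.charpoly.discr) w)) * ((∏ w : PlacesOver L v, IsNonarchimedeanLocalField.normAbs (w.1.adicCompletion L) (((g.val : GL (Fin 3) (UnitaryGroup.LocalRing L v)).val.det) w)) ^ 2)⁻¹)) : ℝ≥0) : ℝ)) (fun x t => F0P3cStCharTSDGFieldReg.dgFormula_conj L v t x) (fun s : ((UnitaryGroup.cmDatum L 2 (Matrix.of fun i j : Fin 2 => if i.val + j.val + 1 = 2 then (1 : L) else 0)).Local v × (UnitaryGroup.cmDatum L 1 (Matrix.of fun i j : Fin 1 => if i.val + j.val + 1 = 1 then (1 : L) else 0)).Local v) => ((NNReal.sqrt (NNReal.sqrt ((∏ w : PlacesOver L v, IsNonarchimedeanLocalField.normAbs (w.1.adicCompletion L) (((s.1.val : GL (Fin 2) (UnitaryGroup.LocalRing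 L v)).val.charpoly.discr) w)) * (∏ w : PlacesOver L v, IsNonarchimedeanLocalField.normAbs (w.1.adicCompletion L) (((s.1.val : GL (Fin 2) (UnitaryGroup.LocalRing L v)).val.det) w))⁻¹)) : ℝ≥0) : ℝ)) hDHst
    (SH.erase ((cmBorelTriple L 2 v).M.prod ⊤)) n γc eT heTc tH hZc hKHc k hclassesc (C.erase (cmBorelTriple L 3 v).M) μTf cQ σ hσm hG hσR hσpair hσexh hnm
    (fun T hT => hsingH T (Finset.mem_of_mem_erase hT))
    (fun Φ' hΦc hΦ0 hΦi => (hE0pkg Φ' hΦc hΦ0 hΦi).2) (fun Φ' hΦc hΦ0 hΦi => (hE0pkg Φ' hΦc hΦ0 hΦi).1)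
    mQv f mHv fH α hαstE hP2σ (fun T' hT' => hIGC T' (Finset.mem_of_mem_erase hT')) (fun T hT => hIHall T (Finset.mem_of_mem_erase hT))
  -- ### `hM` := ★ (U2) at the split members (`hone` ★ (U2b), `hP2` ★ (F2))
  haveI : (μTf (cmBorelTriple L 3 v).M).IsHaarMeasure := hHaarC _ hMC
  haveI : (tH ((cmBorelTriple L 2 v).M.prod ⊤)).IsHaarMeasure := htHh _ hM
  have hMsplit := F0P3cStCharTSUpTrSplitSlot.splitTorus_upIntegrand_eq_of_inputs L v hns μ (fun g : Gqs L v => ((NNReal.sqrt (NNReal.sqrt ((∏ w : PlacesOver L v, IsNonarchimedeanLocalField.normAbs (w.1.adicCompletion L) (((g.val : GL (Fin 3) (UnitaryGroup.LocalRing L v)).val.charpoly.discr) w)) * ((∏ w : PlacesOver L v, IsNonarchimedeanLocalField.normAbs (w.1.adicCompletion L) (((g.val : GL (Fin 3) (UnitaryGroup.LocalRing L v)).val.det) w)) ^ 2)⁻¹)) : ℝ≥0) : ℝ)) (fun x t => F0P3cStCharTSDGFieldReg.dgFormula_conj L v t x) (fun s : ((UnitaryGroup.cmDatum L 2 (Matrix.of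 fun i j : Fin 2 => if i.val + j.val + 1 = 2 then (1 : L) else 0)).Local v × (UnitaryGroup.cmDatum L 1 (Matrix.of fun i j : Fin 1 => if i.val + j.val + 1 = 1 then (1 : L) else 0)).Local v) => ((NNReal.sqrt (NNReal.sqrt ((∏ w : PlacesOver L v, IsNonarchimedeanLocalField.normAbs (w.1.adicCompletion L) (((s.1.val : GL (Fin 2) (UnitaryGroup.LocalRing L v)).val.charpoly.discr) w)) * (∏ w : PlacesOver L v, IsNonarchimedeanLocalField.normAbs (w.1.adicCompletion L) (((s.1.val : GL (Fin 2) (UnitaryGroup.LocalRing L v)).val.det) w))⁻¹)) : ℝ≥0) : ℝ)) hDHst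
    SH n γc hγc eT heT ψ hψ fib hfib hZ hcomplete hirred k hclasses hψR hψuniq hM hMHnc hcpt (tH ((cmBorelTriple L 2 v).M.prod ⊤)) (htH _ hM) (hsingH _ hM)
    C hMC hm₀ hMeq hMnc hcptC hcovC hncC (μTf (cmBorelTriple L 3 v).M) (hcoreC _ hMC)
    (F0P3cStCharTSUpTrSplitFibreOne.hone_splitTorusH L v hns) mQv f mHv fH α hαst
    (fun s hs => F0P3cStCharTSUpTrAssemblyFold.sum_fin_weylDiscrThree_mul_upSummand_eq L v μ _ _ mQv f hns mHv fH hT (γc _) (eT _) (ψ _) (hψ _ hM) (hψR _ hM) (hψuniq _ hM) α s hs)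
    (hIGC _ hMC)
  -- ### ★ (U3)-core
  exact F0P3cStCharTSUpTrAssemblyFullCore.upTransfer_of_inputs L v hns νHv νQv mHv hcanQ μ (fun g : Gqs L v => ((NNReal.sqrt (NNReal.sqrt ((∏ w : PlacesOver L v, IsNonarchimedeanLocalField.normAbs (w.1.adicCompletion L) (((g.val : GL (Fin 3) (UnitaryGroup.LocalRing L v)).val.charpoly.discr) w)) * ((∏ w : PlacesOver L v, IsNonarchimedeanLocalField.normAbs (w.1.adicCompletion L) (((g.val : GL (Fin 3) (UnitaryGroup.LocalRing L v)).val.det) w)) ^ 2)⁻¹)) : ℝ≥0) : ℝ)) (fun x t => F0P3cStCharTSDGFieldReg.dgFormula_conj L v t x) hdGsq (fun s : ((UnitaryGroup.cmDatum L 2 (Matrix.of fun i j : Fin 2 => if i.val + j.val + 1 = 2 then (1 : L) else 0)).Local v × (UnitaryGroup.cmDatum L 1 (Matrix.of fun i j : Fin 1 => if i.val + j.val + 1 = 1 then (1 : L) else 0)).Local v) => ((NNReal.sqrt (NNReal.sqrt ((∏ w : PlacesOver L v, IsNonarchimedeanLocalField.normAbs (w.1.adicCompletion L) (((s.1.val :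 GL (Fin 2) (UnitaryGroup.LocalRing L v)).val.charpoly.discr) w)) * (∏ w : PlacesOver L v, IsNonarchimedeanLocalField.normAbs (w.1.adicCompletion L) (((s.1.val : GL (Fin 2) (UnitaryGroup.LocalRing L v)).val.det) w))⁻¹)) : ℝ≥0) : ℝ))
    C (cmBorelTriple L 3 v).M hMC hZC hcovC hncC μTf hHaarC hinvC hcoreC SH (SH.erase ((cmBorelTriple L 2 v).M.prod ⊤)) ((cmBorelTriple L 2 v).M.prod ⊤)
    (Finset.insert_erase hM).symm (Finset.notMem_erase _ _) tH
    (fun T => ((((T.subgroupOf (Subgroup.normalizer (T : Set ((UnitaryGroup.cmDatum L 2 (Matrix.of fun i j : Fin 2 => if i.val + j.val + 1 = 2 then (1 : L) else 0)).Local v × (UnitaryGroup.cmDatum L 1 (Matrix.of fun i j : Fin 1 => if i.val + j.val + 1 = 1 then (1 : L) else 0)).Local v)))).index : ℂ))⁻¹ * ((k T : ℂ))⁻¹)) hsingH α f hfm fH hEll hMsplit hSW hIG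

end Summit.HodgeConjecture.HodgeConjecture.Cruxes.H413.F0P3cStCharTSUpTrAssemblyFull

end
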